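import Summits.KontsevichZagierPeriods.KontsevichZagierPeriods.Theorems.SoloBlindCyclicSemialgebraic
import Summits.KontsevichZagierPeriods.KontsevichZagierPeriods.Theorems.SoloBlindCyclicTraces
import HarnessLib

/-!
# The cyclic Green datum and the pair trick

For level-`N` data `(k, l)` with `k, l ≥ 1`, `k + l < N` the form `g_{αβ}(z) dz`,
`α = k/N - 1`, `β = l/N - 1`, is a Green datum on `D = {x < ½, y > 0}` (`SoloBlindGreenDatum`),
so `[x = ½, Re g_{αβ}] ≡ [y = 0, -Im g_{αβ}]` in the period algebra (`SoloBlindGreenA`).  The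
forms for `(k, l)` and `(l, k)` have THE SAME trace on the axis `x = ½`
(`Re g_{βα}(½+iy) = Re g_{αβ}(½+iy)`), hence their edge representations are congruent:
`[y = 0, -Im g_{αβ}] ≡ [y = 0, -Im g_{βα}]`.  The edge integrand vanishes on `(0, ½)`, so only
the negative half-line `(-∞, 0)` survives (rule (1a) and a zero integrand).

References: Kontsevich–Zagier, *Periods* (2001), §1.2; Whittaker–Watson, §12.41.
-/

noncomputable section

open Set Complex MeasureTheory Filter
open scoped Topology
open Literature.ModelTheory.ExponentialFields MvPolynomial
open Literature.NumberTheory.Transcendental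
open Literature.NumberTheory.Transcendental.KZ

namespace Summit.KontsevichZagierPeriods.KontsevichZagierPeriods.Theorems

namespace SoloBlind

/-- Level-`N` cyclic data: exponents `k/N - 1`, `l/N - 1` with `k, l ≥ 1`, `k + l < N`. -/
structure CycData where
  /-- the level -/
  N : ℕ
  /-- numerator of `a = k/N` -/
  k : ℕ
  /-- numerator of `b = l/N` -/
  l : ℕ
  hk : 0 < k
  hl : 0 < l
  hkl : k + l < N

namespace CycData

variable (d : CycData)

/-- `N ≥ 2`. -/
theorem two_le : 2 ≤ d.N := by
  have := d.hk; have := d.hl; have := d.hkl; omega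

/-- The exponent inequalities: `-1 < α ≤ 0`, `-1 < β ≤ 0`, `α + β < -1`. -/
theorem exp_bounds :
    (-1 < cycExp d.N d.k ∧ cycExp d.N d.k ≤ 0) ∧ (-1 < cycExp d.N d.l ∧ cycExp d.N d.l ≤ 0) ∧
      cycExp d.N d.k + cycExp d.N d.l < -1 := by
  have hN : (0 : ℝ) < d.N := by
    have h : 0 < d.N := lt_of_le_of_lt (Nat.zero_le _) d.hkl
    exact_mod_cast h
  have hk : (0 : ℝ) < d.k := by exact_mod_cast d.hk
  have hl : (0 : ℝ) < d.l := by exact_mod_cast d.hl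
  have hkl : (d.k : ℝ) + d.l < d.N := by exact_mod_cast d.hkl
  simp only [cycExp]
  refine ⟨⟨by linarith [div_pos hk hN], ?_⟩, ⟨by linarith [div_pos hl hN], ?_⟩, ?_⟩
  · have h : (d.k : ℝ) / d.N ≤ 1 := (div_le_one hN).mpr (by linarith)
    linarith
  · have h : (d.l : ℝ) / d.N ≤ 1 := (div_le_one hN).mpr (by linarith)
    linarith
  · have h : (d.k : ℝ) / d.N + d.l / d.N < 1 := by
      rw [← add_div, div_lt_one hN]; exact hkl
    linarith

/-- The swapped data `(l, k)`. -/
def swap : CycData := ⟨d.N, d.l, d.k, d.hl, d.hk, by rw [add_comm]; exact d.hkl⟩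

/-- **The cyclic Green datum**: `g = g_{αβ}`, `α = k/N - 1`, `β = l/N - 1`. -/
def datum : GreenDatum where
  g := gTwo (cycExp d.N d.k) (cycExp d.N d.l)
  g' := gTwoDer (cycExp d.N d.k) (cycExp d.N d.l)
  hasDerivAt := fun _ _ _ hy =>
    hasDerivAt_gTwo _ _ (mem_slitPlane_pair hy).1 (mem_slitPlane_pair hy).2
  cwa := fun _ hx hx0 => continuousWithinAt_gTwo _ _ hx hx0
  sa_re := (sa_gTwo d.two_le d.k d.l).1
  sa_im := (sa_gTwo d.two_le d.k d.l).2
  sa_h := sa_re_gTwoDer d.two_le d.k d.l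
  integrableOn_h := integrableOn_re_gTwoDer d.exp_bounds.1.1 d.exp_bounds.1.2
    d.exp_bounds.2.1.1.le d.exp_bounds.2.1.2 d.exp_bounds.2.2
  tendsto_atTop := fun x _ => tendsto_gTwo_atTop d.exp_bounds.1.2 d.exp_bounds.2.1.2
    (by linarith [d.exp_bounds.2.2]) x
  tendsto_atBot := fun y _ => tendsto_gTwo_atBot d.exp_bounds.1.2 d.exp_bounds.2.1.2
    (by linarith [d.exp_bounds.2.2]) y
  integrableOn_mid := integrableOn_gTwo_mid d.exp_bounds.1.1.le d.exp_bounds.1.2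
    d.exp_bounds.2.1.1.le d.exp_bounds.2.1.2 d.exp_bounds.2.2
  integrableOn_edge := integrableOn_gTwo_edge d.exp_bounds.1.1 d.exp_bounds.2.2

/-- The datum's `g`. -/
theorem datum_g : d.datum.g = gTwo (cycExp d.N d.k) (cycExp d.N d.l) := rfl

end CycData

/-! ## Generic: congruent axis traces, splitting the edge at `x = 0` -/

namespace GreenDatum

variable (D D' : GreenDatum)

/-- Two data with the same axis trace have congruent axis representations. -/
theorem midRep_congr (h : ∀ y : ℝ, (D.g (((1 / 2 : ℝ) : ℂ) + y * I)).re =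
    (D'.g (((1 / 2 : ℝ) : ℂ) + y * I)).re) : of D.midRep - of D'.midRep ∈ relations := by
  refine of_sub_of_mem_relations_of_eqOn rfl fun x _ => ?_
  simp only [midRep, lineRep_integrand, mid]
  rw [(D.PQH_apply _ _).1, (D'.PQH_apply _ _).1]
  exact h _

/-- `E⁻ = [(-∞,0), -Im g]`. -/
def edgeNegPart : IntegralRep 1 :=
  D.edgeRep.restrict (line (Iio 0)) (isSemialgebraic_line_Iio isAlgebraic_zero)
    fun _ hx => ⟨lt_trans (mem_Iio.mp hx) (by norm_num), (mem_Iio.mp hx).ne⟩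

/-- `E⁺ = [(0,½), -Im g]`. -/
def edgePosPart : IntegralRep 1 :=
  D.edgeRep.restrict (line (Ioo 0 (1 / 2)))
    (isSemialgebraic_line_Ioo isAlgebraic_zero (by simpa using isAlgebraic_rat ℚ (A := ℝ) (1 / 2)))
    fun _ hx => ⟨hx.2, hx.1.ne'⟩

/-- **Rule (1a)**: `[E] - [E⁻] - [E⁺]` is a relation. -/
theorem edge_split : of D.edgeRep - of D.edgeNegPart - of D.edgePosPart ∈ relations := by
  refine domainAddRel_subset_relations ⟨1, D.edgeRep, D.edgeNegPart, D.edgePosPart, ?_, ?_,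
    fun _ _ => rfl, fun _ _ => rfl, rfl⟩
  · simp only [edgeRep, lineRep_domain, edgeNegPart, edgePosPart, IntegralRep.domain_restrict,
      ← line_union, baseA_eq]
  · simp only [edgeNegPart, edgePosPart, IntegralRep.domain_restrict, ← line_inter, volume_line]
    have he : Iio (0 : ℝ) ∩ Ioo 0 (1 / 2) = ∅ := by
      ext x
      simp only [mem_inter_iff, mem_Iio, mem_Ioo, mem_empty_iff_false, iff_false, not_and]
      intro h1 h2
      linarith
    rw [he, measure_empty]

/-- The edge integrand at a real point: `edge x = -Im g(x)`. -/
theorem edge_apply (x : ℝ) : D.edge x = -(D.g x).im := by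
  rw [edge, (D.PQH_apply _ _).2.1]
  simp

/-- If `Im g` vanishes on `(0, ½)` then `[E⁺] ≡ 0`. -/
theorem edgePosPart_mem (h0 : ∀ x : ℝ, 0 < x → x < 1 / 2 → (D.g x).im = 0) :
    of D.edgePosPart ∈ relations := by
  refine of_mem_relations_of_eqOn_zero _ fun x hx => ?_
  have hx' : 0 < x 0 ∧ x 0 < 1 / 2 := hx
  simp only [edgePosPart, IntegralRep.integrand_restrict, edgeRep, lineRep_integrand,
    Pi.zero_apply]
  rw [edge_apply, h0 _ hx'.1 hx'.2, neg_zero]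

/-- ... and then `[E] ≡ [E⁻]`. -/
theorem edgeRep_sub_edgeNegPart (h0 : ∀ x : ℝ, 0 < x → x < 1 / 2 → (D.g x).im = 0) :
    of D.edgeRep - of D.edgeNegPart ∈ relations := by
  have h := relations.add_mem D.edge_split (D.edgePosPart_mem h0)
  convert h using 1
  abel

end GreenDatum

/-! ## The pair trick -/

namespace CycData

variable (d : CycData)

/-- **Same axis trace**: `[x = ½, Re g_{βα}] ≡ [x = ½, Re g_{αβ}]`. -/
theorem midRep_swap : of d.swap.datum.midRep - of d.datum.midRep ∈ relations :=
  GreenDatum.midRep_congr _ _ fun y => re_gTwo_swap_half (cycExp d.N d.k) (cycExp d.N d.l) y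

/-- **The edge representations of `(k, l)` and `(l, k)` are congruent.** -/
theorem edgeRep_swap : of d.datum.edgeRep - of d.swap.datum.edgeRep ∈ relations := by
  have h := relations.sub_mem (relations.sub_mem d.swap.datum.midRep_sub_edgeRep
    d.datum.midRep_sub_edgeRep) d.midRep_swap
  convert h using 1
  abel

/-- `Im g_{αβ}(x) = 0` on `(0, ½)`. -/
theorem im_g_pos (x : ℝ) (h0 : 0 < x) (h1 : x < 1 / 2) : (d.datum.g x).im = 0 :=
  im_gTwo_ofReal_pos h0 (by linarith)

/-- `[E(k,l)] ≡ [E⁻(k,l)]`. -/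
theorem edgeRep_sub_edgeNegPart : of d.datum.edgeRep - of d.datum.edgeNegPart ∈ relations :=
  d.datum.edgeRep_sub_edgeNegPart d.im_g_pos

/-- **`[E⁻(k,l)] ≡ [E⁻(l,k)]`.** -/
theorem edgeNegPart_swap :
    of d.datum.edgeNegPart - of d.swap.datum.edgeNegPart ∈ relations := by
  have h := relations.sub_mem (relations.add_mem d.edgeRep_swap d.swap.edgeRep_sub_edgeNegPart)
    d.edgeRep_sub_edgeNegPart
  convert h using 1
  abel

end CycData

end SoloBlind

end Summit.KontsevichZagierPeriods.KontsevichZagierPeriods.Theorems
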